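import Summits.Ventures.HSemireg.ContractionSpanPointIdeal
import Literature.AlgebraicGeometry.HodgeTheory.JacobianHodgeGenus
import Literature.AlgebraicGeometry.Motives.AbelianVarietyProjectiveChart
import HarnessLib

/-!
# Venture HSemireg — `contractionRank` of a point-ideal class on an abelian variety, on the REAL carriers:
# `r(A, κ) = 2·C(g, 2)` (`g = dim A ≥ 3`) and `= 1` (`g = 2`) whenever the total class is `a·1 + b·ω`, `ω` a top form

HONEST FRAMING. The end-to-end form of th-7's T_lin (`theory/FORMULA-N-th7.md` §N.2/N.5) on the carriers of
`PerfectComplexRankDoor.lean` (seat p4 of the computation cell `pub-hsemireg`): the abstract theorems of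
`ContractionSpanPointIdeal.lean` instantiated at `V = H¹(A(ℂ); ℂ)` (dimension `2g`, tree theorem
`abelianVarietyCohomologyExteriorH1_holds.finrank_one`), `L = H^{0,1}` (the tree's `hodgeZeroOne`, dimension `g`:
`AbelianVariety.finrank_hodgeZeroOne_eq_dim`, with carrier `hodgeZeroOneSet A`), `Θ = vectorFieldSet A = L^⊥`. The
hypothesis «`totalExteriorClass A κ = a·1 + b·ω` with `ω ∈ Λ^{2g} H¹`» is how a consumer says «`κ` is the Chern character
of a point ideal `I_p` (`ch = 1 - [pt]`) read in `Λ H¹`» — it is an INPUT here (th-7 §N.5 dictionary), not derived.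
Nothing here is a claim about any explicit variety; nothing here says that HC / HC_CM / HC_AV holds. Everything PROVED.
-/

noncomputable section

open CliffordAlgebra (contractLeft)
open Module
open Literature.AlgebraicGeometry.Motives Literature.AlgebraicGeometry.HodgeTheory

namespace Summit.Ventures.HSemireg

variable (A : AbelianVariety ℂ)

/-- `hodgeZeroOneSet A` is the carrier of the tree's subspace `H^{0,1} = hodgeZeroOne` (any smooth projective
presentation of `A`). [cite: VoisinHodgeI2002, §7.1.1] -/
theorem coe_hodgeZeroOne_eq_hodgeZeroOneSet {m : ℕ} (hA : IsSmoothProjective m A.X) (hm : m = A.dim) :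
    ((hodgeZeroOne hA : Submodule ℂ (complexBetti A.X 1)) : Set (complexBetti A.X 1)) = hodgeZeroOneSet A := by
  subst hm
  ext x
  rw [SetLike.mem_coe, mem_hodgeZeroOne]
  rfl

/-- `vectorFieldSet A` is the annihilator `{θ : θ|_{H^{0,1}} = 0}` of that subspace. [cite: MumfordAV1970, §4 (iii)] -/
theorem vectorFieldSet_eq {m : ℕ} (hA : IsSmoothProjective m A.X) (hm : m = A.dim) :
    vectorFieldSet A = {θ : Module.Dual ℂ (complexBetti A.X 1) | ∀ q ∈ hodgeZeroOne hA, θ q = 0} := by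
  ext θ
  simp only [vectorFieldSet, Set.mem_setOf_eq, ← SetLike.mem_coe, coe_hodgeZeroOne_eq_hodgeZeroOneSet A hA hm]

/-- **`r(A, κ) = 2·C(g, 2)` for a point-ideal class on an abelian variety of dimension `g ≥ 3`**: if the total class
of `κ` in `Λ H¹(A)` is `a·1 + b·ω` with `a, b ≠ 0` and `ω ≠ 0` of top degree `2g`, then
`contractionRank A κ = 2·C(g, 2)` (T_lin on the real carriers: `dim H¹ = 2g`, `dim H^{0,1} = g`).
[cite: BuchweitzFlenner2008HH, Prop. 6.4.4] [cite: MumfordAV1970, §1 (4) and §4 (iii)]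
[cite: Lange2023AbelianVarietiesC, Thm. 1.1.21 and Lemma 1.1.22] -/
theorem contractionRank_pointIdeal (κ : ∀ p : ℕ, complexBetti A.X (2 * p)) {a b : ℂ} (ha : a ≠ 0) (hb : b ≠ 0)
    {ω : ExteriorAlgebra ℂ (complexBetti A.X 1)} (hω : ω ∈ ⋀[ℂ]^(2 * A.dim) (complexBetti A.X 1)) (hω0 : ω ≠ 0)
    (hx : totalExteriorClass A κ = algebraMap ℂ _ a + b • ω) (hg : 3 ≤ A.dim) :
    contractionRank A κ = ((2 * (A.dim).choose 2 : ℕ) : Cardinal) := by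
  have hA : IsSmoothProjective A.dim A.X := AbelianVariety.isSmoothProjective_holds
  haveI : Module.Finite ℂ (complexBetti A.X 1) := abelianVarietyCohomologyExteriorH1_holds.finite_one A
  have hV : Module.finrank ℂ (complexBetti A.X 1) = 2 * A.dim := abelianVarietyCohomologyExteriorH1_holds.finrank_one A
  have hL : Module.finrank ℂ (hodgeZeroOne hA) = A.dim := AbelianVariety.finrank_hodgeZeroOne_eq_dim A hA
  have hfin := ContractionSpan.finrank_span_pointIdeal hV (hodgeZeroOne hA) hL hω hω0 ha hb hg
  rw [contractionRank_eq_rank_span, hx, vectorFieldSet_eq A hA rfl, ← coe_hodgeZeroOne_eq_hodgeZeroOneSet A hA rfl,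
    ← hfin]
  -- the span is finite-dimensional (sum of the two finite blocks), so `rank = finrank`
  have hVω : ∀ v, ExteriorAlgebra.ι ℂ v * ω = 0 := ContractionSpan.ι_mul_eq_zero_of_mem_top hV hω
  rw [ContractionSpan.span_algebraMap_add_smul (L := ((hodgeZeroOne hA : Submodule ℂ _) : Set (complexBetti A.X 1)))
    (Θ := {θ : Module.Dual ℂ (complexBetti A.X 1) | ∀ q ∈ hodgeZeroOne hA, θ q = 0})
    (fun θ hθ q hq => hθ q hq) (fun q _ => hVω q) (Ne.isUnit ha) (Ne.isUnit hb)]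
  haveI : FiniteDimensional ℂ (ContractionSpan.wedgeBlock (K := ℂ)
      ((hodgeZeroOne hA : Submodule ℂ _) : Set (complexBetti A.X 1))) :=
    Submodule.finiteDimensional_of_le (ContractionSpan.wedgeBlock_le _)
  haveI : FiniteDimensional ℂ (ContractionSpan.contractBlock
      {θ : Module.Dual ℂ (complexBetti A.X 1) | ∀ q ∈ hodgeZeroOne hA, θ q = 0} ω) :=
    Submodule.finiteDimensional_of_le (ContractionSpan.contractBlock_le _ hω)
  exact (Module.finrank_eq_rank ℂ _).symm

/-- **`r(A, κ) = 1` on an abelian SURFACE** (`g = 2`) for a point-ideal class (the two blocks coincide).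
[cite: BuchweitzFlenner2008HH, Prop. 6.4.4] [cite: MumfordAV1970, §1 (4) and §4 (iii)]
[cite: Lange2023AbelianVarietiesC, Thm. 1.1.21 and Lemma 1.1.22] -/
theorem contractionRank_pointIdeal_two (κ : ∀ p : ℕ, complexBetti A.X (2 * p)) {a b : ℂ} (ha : a ≠ 0) (hb : b ≠ 0)
    {ω : ExteriorAlgebra ℂ (complexBetti A.X 1)} (hω : ω ∈ ⋀[ℂ]^(2 * A.dim) (complexBetti A.X 1))
    (hx : totalExteriorClass A κ = algebraMap ℂ _ a + b • ω) (hg : A.dim = 2) :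
    contractionRank A κ = 1 := by
  have hA : IsSmoothProjective A.dim A.X := AbelianVariety.isSmoothProjective_holds
  haveI : Module.Finite ℂ (complexBetti A.X 1) := abelianVarietyCohomologyExteriorH1_holds.finite_one A
  have hV : Module.finrank ℂ (complexBetti A.X 1) = 4 := by
    rw [abelianVarietyCohomologyExteriorH1_holds.finrank_one A, hg]
  have hL : Module.finrank ℂ (hodgeZeroOne hA) = 2 := by rw [AbelianVariety.finrank_hodgeZeroOne_eq_dim A hA, hg]
  have hω' : ω ∈ ⋀[ℂ]^4 (complexBetti A.X 1) := by rwa [hg] at hω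
  have hfin := ContractionSpan.finrank_span_pointIdeal_two hV (hodgeZeroOne hA) hL hω' ha hb
  rw [contractionRank_eq_rank_span, hx, vectorFieldSet_eq A hA rfl, ← coe_hodgeZeroOne_eq_hodgeZeroOneSet A hA rfl]
  have hVω : ∀ v, ExteriorAlgebra.ι ℂ v * ω = 0 := ContractionSpan.ι_mul_eq_zero_of_mem_top hV hω'
  rw [ContractionSpan.span_algebraMap_add_smul (L := ((hodgeZeroOne hA : Submodule ℂ _) : Set (complexBetti A.X 1)))
    (Θ := {θ : Module.Dual ℂ (complexBetti A.X 1) | ∀ q ∈ hodgeZeroOne hA, θ q = 0})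
    (fun θ hθ q hq => hθ q hq) (fun q _ => hVω q) (Ne.isUnit ha) (Ne.isUnit hb)] at hfin ⊢
  haveI : FiniteDimensional ℂ (ContractionSpan.wedgeBlock (K := ℂ)
      ((hodgeZeroOne hA : Submodule ℂ _) : Set (complexBetti A.X 1))) :=
    Submodule.finiteDimensional_of_le (ContractionSpan.wedgeBlock_le _)
  haveI : FiniteDimensional ℂ (ContractionSpan.contractBlock
      {θ : Module.Dual ℂ (complexBetti A.X 1) | ∀ q ∈ hodgeZeroOne hA, θ q = 0} ω) :=
    Submodule.finiteDimensional_of_le (ContractionSpan.contractBlock_le _ hω')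
  rw [← Module.finrank_eq_rank ℂ, hfin, Nat.cast_one]

end Summit.Ventures.HSemireg

end
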